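import Literature.Probability.Percolation.TwoClusterConditionalAssociationProofs
import Literature.Probability.Percolation.PercolationEvents
import Summits.CriticalPhenomena.PercolationContinuityZ3.Theorems.PercNearOneGluingAdditiveGluingBystanderCluster
import Summits.CriticalPhenomena.PercolationContinuityZ3.Theorems.PercNearOneGluingNoHeavyLowerTailSourceRepellerExchange
import HarnessLib

/-!
# `NoHeavyLowerTail` (stmt-CriticalPhenomena-4575) — the repeller frame and the event exchange ZX♭
# (depth prover `nh-dp-commonrelay`, gen 8)

Support file (`--supports stmt-CriticalPhenomena-4575`); no definitions, no named facts, no sorries.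

**The repeller frame.**  Condition on the open edge cluster `W = C_{a₃}` of the repeller (van den Berg–Häggström–Kahn's
display (10)): on `R = {a₁ ↮ a₃}` the configuration off `W̄` (the pairs meeting `{a₃} ∪ V(W)`) is a fresh product configuration,
`{a₃ ↔ b} = {b ∈ V(W)}` and `{a₁ ↔ x} = {a₁ ↔ x off W̄}`.  `sre_sum_cond_gen` is the exact finite-sum identity for an ARBITRARY
function `Ψ(C_{a₃}, ω ∖ W̄)` (generalising `BHK2006.sum_cond_cluster`, which takes `H(C_s, C_t(ω ∖ W̄))`).

**ZX♭ (event form of the source–repeller exchange, PROVED).**  With `E♭ := {a₁↔o} ∪ ({a₂↔o} ∩ {a₂↮a₃})`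
("the observer reaches `a₁`, or reaches `a₂` off the repeller's cluster"),
  `μ(E♭ ∩ R ∩ {a₃↔b}) · μ(R ∩ {a₁↔b}) ≤ μ(E♭ ∩ R ∩ {a₁↔b}) · μ(R ∩ {a₃↔b})`,
i.e. `P(E♭ | R, b ∈ C(a₁)) ≥ P(E♭ | R, b ∈ C(a₃))`.  Proof: on `R ∩ {C_{a₃} = W}`, `E♭ = {o ↔ {a₁,a₂} off W̄}`; Harris in the fresh
variables gives `P(E♭ ∩ {a₁↔b} | C_{a₃} = W) ≥ e(W) β(W)` with `e, β` DECREASING in `W`, while `1{b ∈ V(W)}` is increasing; two applications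
of BHK Thm 1.3 for `C_{a₃}` given `a₃ ↮ a₁` (`e β` vs `1`, and `1{b∈V(W)}` vs `e`) finish.  This is the constant-free part of the registered
row (Y13) (`stub_sourceRepellerExchangeThreeRelays`): (Y13) = ZX♭ + a signed `φ₂`-correction (memo RESIDUAL-gen8.md §7); numerically
ZX♭ has 0 violations / 1 277 exact instances.
[cite: VandenbergHaggstromKahn2005, Thm. 1.3 (p. 6), §1 pp. 7–8 (display (10)); KozmaNitzan2024, Lemma 3 (pp. 6–7), Question 7 (p. 36)]
-/

namespace Summit.CriticalPhenomena.PercolationContinuityZ3.Theorems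

open MeasureTheory Set Literature.Probability.LatticeModels Literature.Probability.Percolation
open Literature.Probability.Percolation.BHK2006 Literature.Probability.Percolation.DecisionTree

noncomputable section

open Classical

variable {n : ℕ}

/-! ### The generalised display (10) -/

/-- `(η ∖ A) ∖ A = η ∖ A`. [folklore] -/
theorem sre_sdiff_sdiff {α : Type*} (η A : Set α) : (η \ A) \ A = η \ A := by
  ext x
  simp only [Set.mem_sdiff]
  tauto

/-- **BHK's display (10) for an arbitrary function of the fresh variables.**  For any
`Ψ : (cluster of s) → (configuration off W̄) → ℝ`,
`E[Ψ(C_s, ω ∖ W̄(C_s))] = E[ E_η[Ψ(C_s(ω), η ∖ W̄(C_s(ω)))] ]` (block Fubini on `W̄`, one `W` at a time).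
[cite: VandenbergHaggstromKahn2005, §1 pp. 7–8, display (10)] -/
theorem sre_sum_cond_gen {V : Type*} [Fintype V] (w : Sym2 V → ℝ) (hm : ∑ ω, weight w ω = 1) (s : V)
    (Ψ : Set (Sym2 V) → Set (Sym2 V) → ℝ) :
    ∑ ω, weight w ω * Ψ (openEdgeCluster ω s) (ω \ {e | ∃ v ∈ e, v = s ∨ ∃ e' ∈ openEdgeCluster ω s, v ∈ e'}) =
      ∑ ω, weight w ω * ∑ η, weight w η *
        Ψ (openEdgeCluster ω s) (η \ {e | ∃ v ∈ e, v = s ∨ ∃ e' ∈ openEdgeCluster ω s, v ∈ e'}) := by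
  have key : ∀ W : Set (Sym2 V),
      ∑ ω, (if openEdgeCluster ω s = W then
          weight w ω * Ψ W (ω \ {e | ∃ v ∈ e, v = s ∨ ∃ e' ∈ W, v ∈ e'}) else 0) =
      ∑ ω, (if openEdgeCluster ω s = W then
          weight w ω * ∑ η, weight w η * Ψ W (η \ {e | ∃ v ∈ e, v = s ∨ ∃ e' ∈ W, v ∈ e'}) else 0) := by
    intro W
    set A : Set (Sym2 V) := {e | ∃ v ∈ e, v = s ∨ ∃ e' ∈ W, v ∈ e'} with hA
    set Φ : Set (Sym2 V) → Set (Sym2 V) → ℝ := fun ζ η =>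
      if openEdgeCluster ζ s = W then Ψ W (η \ A) else 0 with hΦ
    have h1 : ∀ ω, (if openEdgeCluster ω s = W then weight w ω * Ψ W (ω \ A) else 0) =
        weight w ω * Φ (ω ∩ A) (ω \ A) := by
      intro ω
      simp only [hΦ, hA, openEdgeCluster_inter_bar_eq_iff, sre_sdiff_sdiff]
      split_ifs with hW
      · rfl
      · rw [mul_zero]
    have h2 : ∀ ω, weight w ω * ∑ ω', weight w ω' * Φ (ω ∩ A) (ω' \ A) =
        (if openEdgeCluster ω s = W then weight w ω * ∑ η, weight w η * Ψ W (η \ A) else 0) := by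
      intro ω
      simp only [hΦ, hA, openEdgeCluster_inter_bar_eq_iff, sre_sdiff_sdiff]
      split_ifs with hW
      · rfl
      · simp
    calc ∑ ω, (if openEdgeCluster ω s = W then weight w ω * Ψ W (ω \ A) else 0)
        = (∑ ω, weight w ω) * ∑ ω, weight w ω * Φ (ω ∩ A) (ω \ A) := by
          rw [hm, one_mul]; exact Finset.sum_congr rfl fun ω _ => h1 ω
      _ = ∑ ω, weight w ω * ∑ ω', weight w ω' * Φ (ω ∩ A) (ω' \ A) := blockFubini w A Φ
      _ = _ := Finset.sum_congr rfl fun ω _ => h2 ω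
  calc ∑ ω, weight w ω * Ψ (openEdgeCluster ω s) (ω \ {e | ∃ v ∈ e, v = s ∨ ∃ e' ∈ openEdgeCluster ω s, v ∈ e'})
      = ∑ ω, ∑ W, (if openEdgeCluster ω s = W then
          weight w ω * Ψ W (ω \ {e | ∃ v ∈ e, v = s ∨ ∃ e' ∈ W, v ∈ e'}) else 0) :=
        Finset.sum_congr rfl fun ω _ => (Fintype.sum_ite_eq (openEdgeCluster ω s)
          fun W => weight w ω * Ψ W (ω \ {e | ∃ v ∈ e, v = s ∨ ∃ e' ∈ W, v ∈ e'})).symm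
    _ = ∑ W, ∑ ω, (if openEdgeCluster ω s = W then
          weight w ω * Ψ W (ω \ {e | ∃ v ∈ e, v = s ∨ ∃ e' ∈ W, v ∈ e'}) else 0) := Finset.sum_comm
    _ = ∑ W, ∑ ω, (if openEdgeCluster ω s = W then
          weight w ω * ∑ η, weight w η * Ψ W (η \ {e | ∃ v ∈ e, v = s ∨ ∃ e' ∈ W, v ∈ e'}) else 0) :=
        Finset.sum_congr rfl fun W _ => key W
    _ = ∑ ω, ∑ W, (if openEdgeCluster ω s = W then
          weight w ω * ∑ η, weight w η * Ψ W (η \ {e | ∃ v ∈ e, v = s ∨ ∃ e' ∈ W, v ∈ e'}) else 0) :=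
        Finset.sum_comm
    _ = _ := Finset.sum_congr rfl fun ω _ => Fintype.sum_ite_eq (openEdgeCluster ω s)
          fun W => weight w ω * ∑ η, weight w η * Ψ W (η \ {e | ∃ v ∈ e, v = s ∨ ∃ e' ∈ W, v ∈ e'})

/-! ### Reachability off the repeller's cluster -/

/-- A vertex with no pair in `ζ` reaches only itself. [folklore] -/
theorem sre_not_reachable_of_isolated {V : Type*} {ζ : Set (Sym2 V)} {x y : V}
    (h : ∀ c : V, s(x, c) ∉ ζ) (hxy : y ≠ x) : ¬ (openGraph ζ).Reachable x y := by
  rintro ⟨p⟩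
  cases p with
  | nil => exact hxy rfl
  | cons hadj _ => exact h _ ((openGraph_adj ζ _ _).1 hadj).1

/-- **`{a₁ ↔ x} = {a₁ ↔ x off W̄}` on `R`**: if `a₃ ↮ a₁` then `a₁ ↔ x` in `ω` iff `a₁ ↔ x` in the configuration with the pairs
meeting `{a₃} ∪ V(C_{a₃})` deleted. [cite: VandenbergHaggstromKahn2005, §1 p. 8 (proof of Thm. 1.5)] -/
theorem sre_reach_off_bar {V : Type*} (ω : Set (Sym2 V)) (a₃ t x : V) (ht : ¬ (openGraph ω).Reachable a₃ t) :
    (openGraph ω).Reachable t x ↔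
      (openGraph (ω \ {e | ∃ v ∈ e, v = a₃ ∨ ∃ e' ∈ openEdgeCluster ω a₃, v ∈ e'})).Reachable t x := by
  have ht' : ¬ (t = a₃ ∨ ∃ e ∈ openEdgeCluster ω a₃, t ∈ e) := by
    rwa [← reachable_iff_exists_mem_openEdgeCluster]
  have hC := openEdgeCluster_eq_sdiff_bar (s := a₃) (t := t) (W := openEdgeCluster ω a₃) (ω := ω) rfl ht'
  rw [reachable_iff_exists_mem_openEdgeCluster, reachable_iff_exists_mem_openEdgeCluster, hC]

/-- **`{a₂ ↔ o} ∩ {a₂ ↮ a₃} = {a₂ ↔ o off W̄}`** (for `o ≠ a₂`). [folklore] -/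
theorem sre_reach₂_off_bar {V : Type*} (ω : Set (Sym2 V)) (a₃ a₂ o : V) (ho : o ≠ a₂) :
    ((openGraph ω).Reachable a₂ o ∧ ¬ (openGraph ω).Reachable a₂ a₃) ↔
      (openGraph (ω \ {e | ∃ v ∈ e, v = a₃ ∨ ∃ e' ∈ openEdgeCluster ω a₃, v ∈ e'})).Reachable a₂ o := by
  by_cases h : (openGraph ω).Reachable a₃ a₂
  · -- `a₂ ∈ {a₃} ∪ V(C_{a₃})`: every pair at `a₂` is deleted
    have hmem : a₂ = a₃ ∨ ∃ e ∈ openEdgeCluster ω a₃, a₂ ∈ e := by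
      rwa [← reachable_iff_exists_mem_openEdgeCluster]
    constructor
    · rintro ⟨_, h23⟩
      exact absurd h.symm h23
    · intro hr
      refine absurd hr (sre_not_reachable_of_isolated (fun c hc => ?_) ho)
      exact hc.2 ⟨a₂, Sym2.mem_mk_left a₂ c, hmem⟩
  · rw [← sre_reach_off_bar ω a₃ a₂ o h]
    exact ⟨fun h' => h'.1, fun h' => ⟨h', fun h23 => h h23.symm⟩⟩

/-! ### Small real-indicator bookkeeping -/

/-- `ind` of an upper set is monotone. [folklore] -/
theorem sre_ind_mono_of_isUpperSet {α : Type*} [Preorder α] {X : Set α} (hX : IsUpperSet X) :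
    Monotone (ind X) := by
  intro a b hab
  by_cases ha : a ∈ X
  · rw [ind_of_mem ha, ind_of_mem (hX hab ha)]
  · rw [ind_of_not_mem ha]; exact ind_nonneg X b

/-! ### ZX♭: the event form of the source–repeller exchange -/

/-- **ZX♭ (PROVED).**  With `R = {a₁ ↮ a₃}` and `E♭ = {a₁↔o} ∪ ({a₂↔o} ∩ {a₂↮a₃})` (the observer reaches `a₁`, or reaches
`a₂` off the repeller's cluster):  `μ(E♭ ∩ R ∩ {a₃↔b}) · μ(R ∩ {a₁↔b}) ≤ μ(E♭ ∩ R ∩ {a₁↔b}) · μ(R ∩ {a₃↔b})`, i.e.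
`P(E♭ | R, b ∈ C(a₃)) ≤ P(E♭ | R, b ∈ C(a₁))`: moving the target from the repeller's cluster to the source's cluster makes the
observer's attachment (to `a₁`, or to `a₂` off the repeller) more likely.  Repeller frame: condition on `C_{a₃} = W`; Harris in the
fresh variables off `W̄`; BHK Thm 1.3 for `C_{a₃}` given `a₃ ↮ a₁`, twice.
[cite: VandenbergHaggstromKahn2005, Thm. 1.3 (p. 6), §1 pp. 7–8; KozmaNitzan2024, Lemma 3 (pp. 6–7)] -/
theorem sre_exchangeEflat (w : Sym2 (Fin n) → unitInterval) (o b a₁ a₂ a₃ : Fin n) (h13 : a₁ ≠ a₃) (ho2 : o ≠ a₂) :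
    (prodBernoulli w).real ((openConn a₁ o ∪ (openConn a₂ o ∩ (openConn a₂ a₃)ᶜ)) ∩ (openConn a₁ a₃)ᶜ ∩ openConn a₃ b) *
        (prodBernoulli w).real ((openConn a₁ a₃)ᶜ ∩ openConn a₁ b) ≤
      (prodBernoulli w).real ((openConn a₁ o ∪ (openConn a₂ o ∩ (openConn a₂ a₃)ᶜ)) ∩ (openConn a₁ a₃)ᶜ ∩ openConn a₁ b) *
        (prodBernoulli w).real ((openConn a₁ a₃)ᶜ ∩ openConn a₃ b) := by
  classical
  -- the finite-sum world
  set w' : Sym2 (Fin n) → ℝ := fun e => (w e : ℝ) with hw'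
  have hw0 : ∀ e, 0 ≤ w' e := fun e => (w e).2.1
  have hw1 : ∀ e, w' e ≤ 1 := fun e => (w e).2.2
  have hm : ∑ ω, weight w' ω = 1 := by
    have h1 := integral_prodBernoulli_eq_sum w fun _ => (1 : ℝ)
    simp only [integral_const, probReal_univ, smul_eq_mul, mul_one] at h1
    exact h1.symm
  have hreal : ∀ X : Set (BondConfig (Fin n)), (prodBernoulli w).real X = ∑ ω, weight w' ω * ind X ω := by
    intro X
    rw [← integral_indicator_one (MeasurableSet.of_discrete (s := X)), integral_prodBernoulli_eq_sum]
    refine Finset.sum_congr rfl fun ω _ => ?_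
    by_cases hω : ω ∈ X
    · rw [Set.indicator_of_mem hω, ind_of_mem hω, Pi.one_apply]
    · rw [Set.indicator_of_notMem hω, ind_of_not_mem hω, mul_zero]
  set D : Set (BondConfig (Fin n)) := {ω | ∀ x ∈ ({a₁} : Set (Fin n)), ¬ (openGraph ω).Reachable a₃ x} with hD
  have hDmem : ∀ ω, ω ∈ D ↔ ¬ (openGraph ω).Reachable a₃ a₁ := fun ω => by
    simp only [hD, Set.mem_setOf_eq, Set.mem_singleton_iff, forall_eq]
  have hint : ∀ h : Set (Sym2 (Fin n)) → ℝ,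
      ∫ ω in D, h ω ∂(prodBernoulli w) = ∑ ω, weight w' ω * (h ω * ind D ω) := by
    intro h
    rw [← integral_indicator (MeasurableSet.of_discrete (s := D)), integral_prodBernoulli_eq_sum]
    refine Finset.sum_congr rfl fun ω _ => ?_
    by_cases hω : ω ∈ D
    · rw [Set.indicator_of_mem hω, ind_of_mem hω, mul_one]
    · rw [Set.indicator_of_notMem hω, ind_of_not_mem hω]; ring
  -- the functions of the repeller frame
  set fB : Set (Sym2 (Fin n)) → ℝ := ind (openConn a₁ b : Set (BondConfig (Fin n))) with hfB
  set fE : Set (Sym2 (Fin n)) → ℝ := ind (openConn a₁ o ∪ openConn a₂ o : Set (BondConfig (Fin n))) with hfE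
  set τ : Set (Sym2 (Fin n)) → ℝ := ind {W : Set (Sym2 (Fin n)) | b = a₃ ∨ ∃ e ∈ W, b ∈ e} with hτ
  set dD : Set (Sym2 (Fin n)) → ℝ := ind {W : Set (Sym2 (Fin n)) | ¬ (a₁ = a₃ ∨ ∃ e ∈ W, a₁ ∈ e)} with hdD
  set β : Set (Sym2 (Fin n)) → ℝ := fun W =>
    ∑ η, weight w' η * fB (η \ {e | ∃ v ∈ e, v = a₃ ∨ ∃ e' ∈ W, v ∈ e'}) with hβ
  set eE : Set (Sym2 (Fin n)) → ℝ := fun W =>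
    ∑ η, weight w' η * fE (η \ {e | ∃ v ∈ e, v = a₃ ∨ ∃ e' ∈ W, v ∈ e'}) with heE
  -- monotonicity
  have hfBm : Monotone fB := sre_ind_mono_of_isUpperSet (isUpperSet_openConn a₁ b)
  have hfEm : Monotone fE :=
    sre_ind_mono_of_isUpperSet ((isUpperSet_openConn a₁ o).union (isUpperSet_openConn a₂ o))
  have hbarm := bar_mono (V := Fin n) a₃
  have hβa : Antitone β := by
    intro W W' hWW'
    refine Finset.sum_le_sum fun η _ => mul_le_mul_of_nonneg_left ?_ (weight_nonneg hw0 hw1 η)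
    exact hfBm (Set.sdiff_subset_sdiff_right (hbarm hWW'))
  have hea : Antitone eE := by
    intro W W' hWW'
    refine Finset.sum_le_sum fun η _ => mul_le_mul_of_nonneg_left ?_ (weight_nonneg hw0 hw1 η)
    exact hfEm (Set.sdiff_subset_sdiff_right (hbarm hWW'))
  have hτm : Monotone τ := by
    refine sre_ind_mono_of_isUpperSet ?_
    rintro W W' hWW' (h | ⟨e, he, hbe⟩)
    · exact Or.inl h
    · exact Or.inr ⟨e, hWW' he, hbe⟩
  have hβle : ∀ W, β W ≤ 1 := fun W => by
    calc β W ≤ ∑ η, weight w' η * 1 :=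
          Finset.sum_le_sum fun η _ => mul_le_mul_of_nonneg_left (ind_le_one _ _) (weight_nonneg hw0 hw1 η)
      _ = 1 := by rw [← Finset.sum_mul, hm, one_mul]
  have hele : ∀ W, eE W ≤ 1 := fun W => by
    calc eE W ≤ ∑ η, weight w' η * 1 :=
          Finset.sum_le_sum fun η _ => mul_le_mul_of_nonneg_left (ind_le_one _ _) (weight_nonneg hw0 hw1 η)
      _ = 1 := by rw [← Finset.sum_mul, hm, one_mul]
  have hβ0 : ∀ W, 0 ≤ β W := fun W => Finset.sum_nonneg fun η _ => mul_nonneg (weight_nonneg hw0 hw1 η) (ind_nonneg _ _)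
  have he0 : ∀ W, 0 ≤ eE W := fun W => Finset.sum_nonneg fun η _ => mul_nonneg (weight_nonneg hw0 hw1 η) (ind_nonneg _ _)
  -- pointwise identities on the repeller frame
  have hdpt : ∀ ω : BondConfig (Fin n), ind D ω = dD (openEdgeCluster ω a₃) := fun ω =>
    BystanderBHK.ind_congr (by rw [hDmem, reachable_iff_exists_mem_openEdgeCluster]; rfl)
  have hTpt : ∀ ω : BondConfig (Fin n), ind (openConn a₃ b : Set (BondConfig (Fin n))) ω = τ (openEdgeCluster ω a₃) :=
    fun ω => BystanderBHK.ind_congr (by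
      show (openGraph ω).Reachable a₃ b ↔ _
      rw [reachable_iff_exists_mem_openEdgeCluster]; rfl)
  have hBpt : ∀ ω : BondConfig (Fin n), ω ∈ D →
      ind (openConn a₁ b : Set (BondConfig (Fin n))) ω =
        fB (ω \ {e | ∃ v ∈ e, v = a₃ ∨ ∃ e' ∈ openEdgeCluster ω a₃, v ∈ e'}) := fun ω hω =>
    BystanderBHK.ind_congr (sre_reach_off_bar ω a₃ a₁ b ((hDmem ω).1 hω))
  have hEpt : ∀ ω : BondConfig (Fin n), ω ∈ D →
      ind ((openConn a₁ o ∪ (openConn a₂ o ∩ (openConn a₂ a₃)ᶜ)) : Set (BondConfig (Fin n))) ω =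
        fE (ω \ {e | ∃ v ∈ e, v = a₃ ∨ ∃ e' ∈ openEdgeCluster ω a₃, v ∈ e'}) := fun ω hω =>
    BystanderBHK.ind_congr (by
      simp only [Set.mem_union, Set.mem_inter_iff, Set.mem_compl_iff]
      show ((openGraph ω).Reachable a₁ o ∨ ((openGraph ω).Reachable a₂ o ∧ ¬ (openGraph ω).Reachable a₂ a₃)) ↔
        ((openGraph _).Reachable a₁ o ∨ (openGraph _).Reachable a₂ o)
      rw [sre_reach_off_bar ω a₃ a₁ o ((hDmem ω).1 hω), sre_reach₂_off_bar ω a₃ a₂ o ho2])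
  -- the four measures as sums over the repeller frame
  have hRD : ((openConn a₁ a₃)ᶜ : Set (BondConfig (Fin n))) = D := by
    ext ω
    rw [hDmem, Set.mem_compl_iff]
    exact ⟨fun h h' => h h'.symm, fun h h' => h h'.symm⟩
  have hsplit : ∀ (X Y : Set (BondConfig (Fin n))) (ω : BondConfig (Fin n)),
      ind (X ∩ (openConn a₁ a₃)ᶜ ∩ Y) ω = ind X ω * ind Y ω * ind D ω := by
    intro X Y ω
    rw [ind_inter, ind_inter, hRD]; ring
  have hsplit' : ∀ (Y : Set (BondConfig (Fin n))) (ω : BondConfig (Fin n)),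
      ind ((openConn a₁ a₃)ᶜ ∩ Y) ω = ind Y ω * ind D ω := by
    intro Y ω
    rw [ind_inter, hRD]; ring
  -- μ(E♭ ∩ R ∩ T) = Σ (τ · e)(C₃) 1_D
  have hM1 : (prodBernoulli w).real ((openConn a₁ o ∪ (openConn a₂ o ∩ (openConn a₂ a₃)ᶜ)) ∩ (openConn a₁ a₃)ᶜ ∩ openConn a₃ b) =
      ∑ ω, weight w' ω * ((τ (openEdgeCluster ω a₃) * eE (openEdgeCluster ω a₃)) * ind D ω) := by
    rw [hreal]
    have step : ∀ ω : BondConfig (Fin n),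
        weight w' ω * ind ((openConn a₁ o ∪ (openConn a₂ o ∩ (openConn a₂ a₃)ᶜ)) ∩ (openConn a₁ a₃)ᶜ ∩ openConn a₃ b) ω =
        weight w' ω * ((τ (openEdgeCluster ω a₃) * fE (ω \ {e | ∃ v ∈ e, v = a₃ ∨ ∃ e' ∈ openEdgeCluster ω a₃, v ∈ e'})) *
          dD (openEdgeCluster ω a₃)) := by
      intro ω
      rw [hsplit]
      by_cases hω : ω ∈ D
      · rw [hEpt ω hω, hTpt ω, ← hdpt ω]; ring
      · rw [← hdpt ω, ind_of_not_mem hω]; ring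
    rw [Finset.sum_congr rfl fun ω _ => step ω,
      sre_sum_cond_gen w' hm a₃ (fun W ζ => (τ W * fE ζ) * dD W)]
    refine Finset.sum_congr rfl fun ω _ => ?_
    rw [hdpt ω]
    simp only [heE, Finset.mul_sum, Finset.sum_mul]
    exact Finset.sum_congr rfl fun η _ => by ring
  -- μ(R ∩ B) = Σ β(C₃) 1_D
  have hM2 : (prodBernoulli w).real ((openConn a₁ a₃)ᶜ ∩ openConn a₁ b) =
      ∑ ω, weight w' ω * (β (openEdgeCluster ω a₃) * ind D ω) := by
    rw [hreal]
    have step : ∀ ω : BondConfig (Fin n), weight w' ω * ind ((openConn a₁ a₃)ᶜ ∩ openConn a₁ b) ω =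
        weight w' ω * (fB (ω \ {e | ∃ v ∈ e, v = a₃ ∨ ∃ e' ∈ openEdgeCluster ω a₃, v ∈ e'}) * dD (openEdgeCluster ω a₃)) := by
      intro ω
      rw [hsplit']
      by_cases hω : ω ∈ D
      · rw [hBpt ω hω, ← hdpt ω]
      · rw [← hdpt ω, ind_of_not_mem hω]; ring
    rw [Finset.sum_congr rfl fun ω _ => step ω, sre_sum_cond_gen w' hm a₃ (fun W ζ => fB ζ * dD W)]
    refine Finset.sum_congr rfl fun ω _ => ?_
    rw [hdpt ω]
    simp only [hβ, Finset.mul_sum, Finset.sum_mul]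
    exact Finset.sum_congr rfl fun η _ => by ring
  -- μ(E♭ ∩ R ∩ B) ≥ Σ (β e)(C₃) 1_D   (Harris in the fresh variables)
  have hM3 : ∑ ω, weight w' ω * ((β (openEdgeCluster ω a₃) * eE (openEdgeCluster ω a₃)) * ind D ω) ≤
      (prodBernoulli w).real ((openConn a₁ o ∪ (openConn a₂ o ∩ (openConn a₂ a₃)ᶜ)) ∩ (openConn a₁ a₃)ᶜ ∩ openConn a₁ b) := by
    rw [hreal]
    have step : ∀ ω : BondConfig (Fin n),
        weight w' ω * ind ((openConn a₁ o ∪ (openConn a₂ o ∩ (openConn a₂ a₃)ᶜ)) ∩ (openConn a₁ a₃)ᶜ ∩ openConn a₁ b) ω =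
        weight w' ω * ((fB (ω \ {e | ∃ v ∈ e, v = a₃ ∨ ∃ e' ∈ openEdgeCluster ω a₃, v ∈ e'}) *
          fE (ω \ {e | ∃ v ∈ e, v = a₃ ∨ ∃ e' ∈ openEdgeCluster ω a₃, v ∈ e'})) * dD (openEdgeCluster ω a₃)) := by
      intro ω
      rw [hsplit]
      by_cases hω : ω ∈ D
      · rw [hEpt ω hω, hBpt ω hω, ← hdpt ω]; ring
      · rw [← hdpt ω, ind_of_not_mem hω]; ring
    rw [Finset.sum_congr rfl fun ω _ => step ω, sre_sum_cond_gen w' hm a₃ (fun W ζ => (fB ζ * fE ζ) * dD W)]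
    refine Finset.sum_le_sum fun ω _ => mul_le_mul_of_nonneg_left ?_ (weight_nonneg hw0 hw1 ω)
    rw [hdpt ω]
    -- Harris for the fixed deleted set `A = W̄(C₃(ω))`
    set A : Set (Sym2 (Fin n)) := {e | ∃ v ∈ e, v = a₃ ∨ ∃ e' ∈ openEdgeCluster ω a₃, v ∈ e'} with hA
    have hH := harris hw0 hw1 (f := fun η => fB (η \ A)) (g := fun η => fE (η \ A))
      (fun η => ind_nonneg _ _) (fun η => ind_nonneg _ _)
      (fun η η' h => hfBm (Set.sdiff_subset_sdiff_left h)) (fun η η' h => hfEm (Set.sdiff_subset_sdiff_left h))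
    rw [hm, one_mul] at hH
    have hsum : ∑ η, weight w' η * (fB (η \ A) * fE (η \ A) * dD (openEdgeCluster ω a₃)) =
        (∑ η, weight w' η * (fB (η \ A) * fE (η \ A))) * dD (openEdgeCluster ω a₃) := by
      rw [Finset.sum_mul]
      exact Finset.sum_congr rfl fun η _ => by ring
    rw [hsum]
    exact mul_le_mul_of_nonneg_right hH (ind_nonneg _ _)
  -- μ(R ∩ T) = Σ τ(C₃) 1_D
  have hM4 : (prodBernoulli w).real ((openConn a₁ a₃)ᶜ ∩ openConn a₃ b) =
      ∑ ω, weight w' ω * (τ (openEdgeCluster ω a₃) * ind D ω) := by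
    rw [hreal]
    refine Finset.sum_congr rfl fun ω _ => ?_
    rw [hsplit', hTpt ω]
  -- BHK Thm 1.3 for `C_{a₃}` given `a₃ ↮ a₁`: (i) `e, β` both decreasing; (ii) `τ` increasing, `e` decreasing
  have ha : a₃ ∉ ({a₁} : Set (Fin n)) := by simpa using fun h => h13 h.symm
  have h1 := BHK2006_clusterConditionalPositiveAssociation_holds (Fin n) w a₃ ({a₁} : Set (Fin n))
    (fun W => 1 - eE W) (fun W => 1 - β W) (fun W W' h => by linarith [hea h]) (fun W W' h => by linarith [hβa h]) ha
  have h2 := BHK2006_clusterConditionalPositiveAssociation.antitone_right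
    BHK2006_clusterConditionalPositiveAssociation_holds (Fin n) w a₃ ({a₁} : Set (Fin n)) τ eE hτm hea ha
  rw [hint, hint, hint, hreal] at h1
  rw [hint, hint, hint, hreal] at h2
  -- name the sums
  set P := ∑ ω, weight w' ω * ind D ω with hP
  set Se := ∑ ω, weight w' ω * (eE (openEdgeCluster ω a₃) * ind D ω) with hSe
  set Sb := ∑ ω, weight w' ω * (β (openEdgeCluster ω a₃) * ind D ω) with hSb
  set Seb := ∑ ω, weight w' ω * ((β (openEdgeCluster ω a₃) * eE (openEdgeCluster ω a₃)) * ind D ω) with hSeb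
  set Ste := ∑ ω, weight w' ω * ((τ (openEdgeCluster ω a₃) * eE (openEdgeCluster ω a₃)) * ind D ω) with hSte
  set St := ∑ ω, weight w' ω * (τ (openEdgeCluster ω a₃) * ind D ω) with hSt
  -- linear expansions of the sums in h1
  have x1 : ∑ ω, weight w' ω * ((1 - eE (openEdgeCluster ω a₃)) * ind D ω) = P - Se := by
    rw [hP, hSe, ← Finset.sum_sub_distrib]; exact Finset.sum_congr rfl fun ω _ => by ring
  have x2 : ∑ ω, weight w' ω * ((1 - β (openEdgeCluster ω a₃)) * ind D ω) = P - Sb := by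
    rw [hP, hSb, ← Finset.sum_sub_distrib]; exact Finset.sum_congr rfl fun ω _ => by ring
  have x3 : ∑ ω, weight w' ω * ((1 - eE (openEdgeCluster ω a₃)) * (1 - β (openEdgeCluster ω a₃)) * ind D ω) =
      P - Se - Sb + Seb := by
    rw [hP, hSe, hSb, hSeb, ← Finset.sum_sub_distrib, ← Finset.sum_sub_distrib, ← Finset.sum_add_distrib]
    exact Finset.sum_congr rfl fun ω _ => by ring
  rw [x1, x2, x3] at h1
  have hA1 : Se * Sb ≤ P * Seb := by nlinarith [h1]
  have hA2 : P * Ste ≤ St * Se := by linarith [h2]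
  -- nonnegativity
  have hP0 : 0 ≤ P := Finset.sum_nonneg fun ω _ => mul_nonneg (weight_nonneg hw0 hw1 ω) (ind_nonneg _ _)
  have hSb0 : 0 ≤ Sb := Finset.sum_nonneg fun ω _ =>
    mul_nonneg (weight_nonneg hw0 hw1 ω) (mul_nonneg (hβ0 _) (ind_nonneg _ _))
  have hSt0 : 0 ≤ St := Finset.sum_nonneg fun ω _ =>
    mul_nonneg (weight_nonneg hw0 hw1 ω) (mul_nonneg (ind_nonneg _ _) (ind_nonneg _ _))
  have hSte0 : 0 ≤ Ste := Finset.sum_nonneg fun ω _ =>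
    mul_nonneg (weight_nonneg hw0 hw1 ω) (mul_nonneg (mul_nonneg (ind_nonneg _ _) (he0 _)) (ind_nonneg _ _))
  have hSeb0 : 0 ≤ Seb := Finset.sum_nonneg fun ω _ =>
    mul_nonneg (weight_nonneg hw0 hw1 ω) (mul_nonneg (mul_nonneg (hβ0 _) (he0 _)) (ind_nonneg _ _))
  have hSbP : Sb ≤ P := by
    rw [hSb, hP]
    refine Finset.sum_le_sum fun ω _ => mul_le_mul_of_nonneg_left ?_ (weight_nonneg hw0 hw1 ω)
    calc β (openEdgeCluster ω a₃) * ind D ω ≤ 1 * ind D ω := mul_le_mul_of_nonneg_right (hβle _) (ind_nonneg _ _)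
      _ = ind D ω := one_mul _
  -- assemble
  rw [hM1, hM2, hM4]
  have hM3' : Seb ≤ (prodBernoulli w).real
      ((openConn a₁ o ∪ (openConn a₂ o ∩ (openConn a₂ a₃)ᶜ)) ∩ (openConn a₁ a₃)ᶜ ∩ openConn a₁ b) := hM3
  have hgoal : Ste * Sb ≤ Seb * St := by
    by_cases hPz : P = 0
    · have hSbz : Sb = 0 := le_antisymm (hPz ▸ hSbP) hSb0
      rw [hSbz, mul_zero]
      exact mul_nonneg hSeb0 hSt0
    · have hPpos : 0 < P := lt_of_le_of_ne hP0 (Ne.symm hPz)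
      nlinarith [hA1, hA2, hSt0, hSb0, hSte0, mul_le_mul_of_nonneg_left hA1 hSt0, mul_le_mul_of_nonneg_right hA2 hSb0]
  calc Ste * Sb ≤ Seb * St := hgoal
    _ ≤ _ := mul_le_mul_of_nonneg_right hM3' hSt0

end

end Summit.CriticalPhenomena.PercolationContinuityZ3.Theorems
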